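import Mathlib
import Literature.Computability.AlgebraicComplexity.DeterminantalConormalBoundMixed

/-!
# Crux `DetQP.DetqpSuperquadratic` (stmt-ValiantsHypothesis-0318), line `sectional-class-ladder`
# (skeleton v2, ND route) — helper for stub `stub_polarCountND`: second-order Jacobi calculus and
# infinitesimal rigidity of a non-degenerate polar point

`stub_polarCountND` (Sheshadri's bound `B(m, N)` for finite sets of NON-DEGENERATE polar points
of `f = det A`, `A` affine `m × m`) is the tree's `ncard_polarSet_le_conormalBezout_of_pencil`
(arXiv:2606.13628 §3.1) with isolation replaced by a Jacobian-kernel computation: the lift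
`z_x = (1 : x, u_x, v_x)` of a non-degenerate polar point is a non-degenerate zero of the
kernel-incidence system (every tangent vector `(δ₀; δx; δu; δv)` at `z_x` is a torus direction).
This file is the point-wise linear algebra, for an affine matrix `A` at a corank-one point `x`
with kernel pair `(u, v)` (`uᵀ A(x) = 0`, `A(x) v = 0`, `adj A(x) = v uᵀ`):
* `PolarCountND.eval_mkDerivation_eq_sum` — `Σ_t (∂_t p)(y) w_t` is the evaluation at `y` of the
  derivation `D_w = Σ_t w_t ∂_t`; `map_mul_derivation` etc. — Leibniz for polynomial matrices;
* `PolarCountND.hessian_mulVec_eq` — **second-order Jacobi**: if `E = Σ_j δx_j A_j`,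
  `A(x) δv + E v = 0`, `δuᵀ A(x) + uᵀ E = 0`, then
  `Hess(det A)(x) δx = (δuᵀ A_i v + uᵀ A_i δv)_i + λ ∇(det A)(x)` (differentiate
  `adj A · A = det A · 1 = A · adj A` along `Σ_j δx_j ∂_j`: the defect of `D(adj A)(x)` is killed
  by `A(x)` on both sides, hence is `λ v uᵀ`);
* `PolarCountND.eq_zero_of_vecMul_reduction` (`ρ Λ = 0, ρ·v = 0 ⇒ ρ = 0`),
  `PolarCountND.eq_zero_of_borderedHessian_det_ne_zero`, and the assembly
  `polarLift_rigidity_of_nondegenerate`: the linearised chart, kernel, reduced left-kernel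
  and pencil equations at a non-degenerate polar point force `δx = 0`, `δu ∈ ℂu`, `δv ∈ ℂv`.
References: K. Sheshadri, arXiv:2606.13628 (2026), §3.1 [Sheshadri2026Border]; W. Fulton,
*Intersection Theory*, 2nd ed., 1998, Example 12.3.1 [Fulton1998].
-/

noncomputable section

-- `Summit.ValiantsHypothesis.ValiantsHypothesis.…` is the tree's mandated single-conjunct layout
-- (Sub = Summit), so the duplicated namespace component is intended.
set_option linter.dupNamespace false

namespace Summit.ValiantsHypothesis.ValiantsHypothesis.Theorems.DetQPDetqpSuperquadratic

open MvPolynomial Matrix Finset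
open Literature.Computability.AlgebraicComplexity
open Literature.Computability.AlgebraicComplexity.DeterminantalConormal

namespace PolarCountND

/-- **Directional derivative as a derivation.** For a direction `w`, the derivation
`D_w = Σ_t w_t ∂_t` of `ℂ[X_τ]` (`MvPolynomial.mkDerivation` with values `D_w(X_t) = w_t`)
evaluates at a point `y` to the Jacobian pairing `Σ_t (∂_t p)(y) w_t`. [folklore] -/
theorem eval_mkDerivation_eq_sum {τ : Type*} [Fintype τ] (y w : τ → ℂ) (p : MvPolynomial τ ℂ) :
    eval y (mkDerivation ℂ (fun t => (C (w t) : MvPolynomial τ ℂ)) p) =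
      ∑ t, eval y (pderiv t p) * w t := by
  classical
  induction p using MvPolynomial.induction_on with
  | C r => simp
  | add p q hp hq => simp only [map_add, hp, hq, add_mul, Finset.sum_add_distrib]
  | mul_X p s hp =>
    have hX : ∀ t, eval y (pderiv t (X s : MvPolynomial τ ℂ)) = if s = t then 1 else 0 := by
      intro t
      by_cases h : s = t
      · subst h; simp
      · rw [pderiv_X_of_ne h, if_neg h, map_zero]
    rw [Derivation.leibniz, mkDerivation_X, smul_eq_mul, smul_eq_mul, map_add, map_mul, map_mul,
      eval_C, eval_X, hp]
    simp only [pderiv_mul, map_add, map_mul, eval_X, hX, add_mul, Finset.sum_add_distrib, mul_ite,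
      mul_one, mul_zero, ite_mul, zero_mul, Finset.sum_ite_eq, Finset.mem_univ, if_true]
    rw [add_comm, Finset.mul_sum]
    exact congrArg₂ (· + ·) (Finset.sum_congr rfl fun t _ => by ring) rfl

/-- **Leibniz rule for matrix products**: a derivation acts on `P Q` entrywise as
`D(PQ) = D(P) Q + P D(Q)`. [folklore] -/
theorem map_mul_derivation {R S : Type*} [CommRing R] [CommRing S] [Algebra R S] {l m n : Type*}
    [Fintype m] (D : Derivation R S S) (P : Matrix l m S) (Q : Matrix m n S) :
    (P * Q).map D = P.map D * Q + P * Q.map D := by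
  refine Matrix.ext fun i k => ?_
  simp only [Matrix.map_apply, Matrix.mul_apply, Matrix.add_apply, map_sum, Derivation.leibniz,
    smul_eq_mul, Finset.sum_add_distrib]
  rw [add_comm]
  exact congrArg₂ (· + ·) (Finset.sum_congr rfl fun j _ => mul_comm _ _) rfl

/-- A derivation maps the scalar matrix `r • 1` to `D(r) • 1`. [folklore] -/
theorem map_smul_one_derivation {R S : Type*} [CommRing R] [CommRing S] [Algebra R S] {n : Type*}
    [DecidableEq n] (D : Derivation R S S) (r : S) :
    (r • (1 : Matrix n n S)).map D = D r • (1 : Matrix n n S) := by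
  refine Matrix.ext fun i k => ?_
  simp only [Matrix.map_apply, Matrix.smul_apply, Matrix.one_apply, smul_eq_mul, mul_ite, mul_one,
    mul_zero]
  split_ifs <;> simp

/-- A matrix of constants is killed by every derivation of `ℂ[X_σ]`. [folklore] -/
theorem map_C_map_derivation {σ : Type*} {l n : Type*}
    (D : Derivation ℂ (MvPolynomial σ ℂ) (MvPolynomial σ ℂ)) (N : Matrix l n ℂ) :
    (N.map (C : ℂ → MvPolynomial σ ℂ)).map D = 0 := by
  refine Matrix.ext fun i k => ?_
  simp only [Matrix.map_apply, Matrix.zero_apply]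
  exact derivation_C D _

/-- Bilinearity bookkeeping: `Σ_j (uᵀ A_j v) δx_j = uᵀ E v` for `E = Σ_j δx_j A_j`. [folklore] -/
theorem sum_dotProduct_mulVec_mul_eq {σ : Type*} [Fintype σ] {k : ℕ}
    (A : Matrix (Fin k) (Fin k) (MvPolynomial σ ℂ)) (u v : Fin k → ℂ) (δx : σ → ℂ)
    (E : Matrix (Fin k) (Fin k) ℂ)
    (hE : ∀ r c, E r c = ∑ j, coeff (Finsupp.single j 1) (A r c) * δx j) :
    ∑ j, (u ⬝ᵥ (A.map (fun p => coeff (Finsupp.single j 1) p) *ᵥ v)) * δx j = u ⬝ᵥ (E *ᵥ v) := by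
  simp only [dotProduct, mulVec, hE, Matrix.map_apply, Finset.sum_mul, Finset.mul_sum]
  rw [Finset.sum_comm]
  refine Finset.sum_congr rfl fun r _ => ?_
  rw [Finset.sum_comm]
  exact Finset.sum_congr rfl fun c _ => Finset.sum_congr rfl fun j _ => by ring

/-- **Second-order Jacobi at a corank-one point.** Let `A` be a square matrix of affine-linear
forms, `x` a point where `A(x)` has kernel pair `(u, v)` (`uᵀ A(x) = 0`, `A(x) v = 0`,
`adj A(x) = v uᵀ`), and `(δx, δu, δv)` a first-order deformation with `E = Σ_j δx_j A_j`
satisfying the linearised kernel equations `A(x) δv + E v = 0` and `δuᵀ A(x) + uᵀ E = 0`. Then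
`Hess(det A)(x) δx = (δuᵀ A_i v + uᵀ A_i δv)_i + λ (uᵀ A_i v)_i` for some scalar `λ`:
differentiating `adj A · A = det A · 1 = A · adj A` along `D = Σ_j δx_j ∂_j` shows that
`D(adj A)(x) − v δuᵀ − δv uᵀ` is killed by `A(x)` on both sides, hence is `λ v uᵀ` (corank
exactly one), and `∂_i det A = tr(adj A · A_i)` (Jacobi). [folklore] -/
theorem hessian_mulVec_eq {σ : Type*} [Fintype σ] {k : ℕ}
    (A : Matrix (Fin k) (Fin k) (MvPolynomial σ ℂ)) (hA1 : ∀ r c, (A r c).totalDegree ≤ 1)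
    (x : σ → ℂ) (u v : Fin k → ℂ) (hu : u ≠ 0) (hv : v ≠ 0)
    (huM : u ᵥ* A.map (eval x) = 0) (hMv : A.map (eval x) *ᵥ v = 0)
    (hadj : (A.map (eval x)).adjugate = vecMulVec v u)
    (δx : σ → ℂ) (δu δv : Fin k → ℂ) (E : Matrix (Fin k) (Fin k) ℂ)
    (hE : ∀ r c, E r c = ∑ j, coeff (Finsupp.single j 1) (A r c) * δx j)
    (hb : A.map (eval x) *ᵥ δv + E *ᵥ v = 0)
    (hc : δu ᵥ* A.map (eval x) + u ᵥ* E = 0) :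
    ∃ lam : ℂ, ∀ i, ∑ j, eval x (pderiv i (pderiv j A.det)) * δx j =
      δu ⬝ᵥ (A.map (fun p => coeff (Finsupp.single i 1) p) *ᵥ v) +
        u ⬝ᵥ (A.map (fun p => coeff (Finsupp.single i 1) p) *ᵥ δv) +
        lam * (u ⬝ᵥ (A.map (fun p => coeff (Finsupp.single i 1) p) *ᵥ v)) := by
  classical
  set M := A.map (eval x) with hM
  set Ai : σ → Matrix (Fin k) (Fin k) ℂ := fun i => A.map (fun p => coeff (Finsupp.single i 1) p)
    with hAi
  set D : Derivation ℂ (MvPolynomial σ ℂ) (MvPolynomial σ ℂ) :=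
    mkDerivation ℂ (fun j => (C (δx j) : MvPolynomial σ ℂ)) with hD
  have hlink : ∀ p, eval x (D p) = ∑ j, eval x (pderiv j p) * δx j :=
    eval_mkDerivation_eq_sum x δx
  -- corank exactly one
  have hdet : M.det = 0 := Matrix.exists_mulVec_eq_zero_iff.mp ⟨v, hv, hMv⟩
  have hadj0 : M.adjugate ≠ 0 := by
    rw [hadj]; exact fun h0 => (vecMulVec_eq_zero.mp h0).elim hv hu
  -- the derivative matrices
  have hApd : ∀ i, A.map (pderiv i) = (Ai i).map (C : ℂ → MvPolynomial σ ℂ) := by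
    intro i
    refine Matrix.ext fun r c => ?_
    simp only [Matrix.map_apply, hAi]
    exact pderiv_eq_C_coeff_of_totalDegree_le_one (hA1 r c) i
  have hDA : (A.map D).map (eval x) = E := by
    refine Matrix.ext fun r c => ?_
    rw [Matrix.map_apply, Matrix.map_apply, hlink, hE]
    exact Finset.sum_congr rfl fun j _ => by
      rw [eval_pderiv_eq_coeff_of_totalDegree_le_one (hA1 r c)]
  have hadjx : A.adjugate.map (eval x) = M.adjugate := by
    have h := RingHom.map_adjugate (eval x) A
    rw [RingHom.mapMatrix_apply, RingHom.mapMatrix_apply] at h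
    exact h
  have hCe : ∀ N : Matrix (Fin k) (Fin k) ℂ,
      (N.map (C : ℂ → MvPolynomial σ ℂ)).map (eval x) = N := by
    intro N
    refine Matrix.ext fun r c => ?_
    simp
  set Δ := (A.adjugate.map D).map (eval x) with hΔ
  -- Jacobi: `∂_i det A (x) = uᵀ A_i v`
  have hAi' : ∀ i, A.map (fun p => eval x (pderiv i p)) = Ai i := by
    intro i
    refine Matrix.ext fun r c => ?_
    simp only [Matrix.map_apply, hAi]
    exact eval_pderiv_eq_coeff_of_totalDegree_le_one (hA1 r c) i x
  have hpd : ∀ i, eval x (pderiv i A.det) = u ⬝ᵥ (Ai i *ᵥ v) := by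
    intro i
    rw [eval_pderiv_det, hadj, vecMulVec_mul, trace_vecMulVec, dotProduct_comm, ← dotProduct_mulVec,
      hAi' i]
  have huE : u ⬝ᵥ (E *ᵥ v) = 0 := by
    have h1 : u ⬝ᵥ (M *ᵥ δv + E *ᵥ v) = 0 := by rw [hb, dotProduct_zero]
    rwa [dotProduct_add, dotProduct_mulVec, huM, zero_dotProduct, zero_add] at h1
  have hscalar : eval x (D A.det) = 0 := by
    rw [hlink]
    calc ∑ j, eval x (pderiv j A.det) * δx j = ∑ j, (u ⬝ᵥ (Ai j *ᵥ v)) * δx j :=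
          Finset.sum_congr rfl fun j _ => by rw [hpd]
      _ = u ⬝ᵥ (E *ᵥ v) := sum_dotProduct_mulVec_mul_eq A u v δx E hE
      _ = 0 := huE
  -- differentiate `adj A · A = det A · 1` and `A · adj A = det A · 1`
  have h1 : Δ * M + M.adjugate * E = 0 := by
    have h := congrArg (fun N : Matrix (Fin k) (Fin k) (MvPolynomial σ ℂ) => (N.map D).map (eval x))
      (Matrix.adjugate_mul A)
    rw [map_mul_derivation, map_smul_one_derivation,
      Matrix.map_add _ (fun a₁ a₂ => map_add (eval x) a₁ a₂), Matrix.map_mul, Matrix.map_mul,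
      hadjx, hDA] at h
    rw [h]
    refine Matrix.ext fun r c => ?_
    simp [hscalar]
  have h2 : M * Δ + E * M.adjugate = 0 := by
    have h := congrArg (fun N : Matrix (Fin k) (Fin k) (MvPolynomial σ ℂ) => (N.map D).map (eval x))
      (Matrix.mul_adjugate A)
    rw [map_mul_derivation, map_smul_one_derivation,
      Matrix.map_add _ (fun a₁ a₂ => map_add (eval x) a₁ a₂), Matrix.map_mul, Matrix.map_mul,
      hadjx, hDA] at h
    rw [add_comm, h]
    refine Matrix.ext fun r c => ?_
    simp [hscalar]
  have hΔM : Δ * M = vecMulVec v δu * M := by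
    have hcE : u ᵥ* E = -(δu ᵥ* M) := eq_neg_of_add_eq_zero_right hc
    rw [eq_neg_of_add_eq_zero_left h1, hadj, vecMulVec_mul, vecMulVec_mul, hcE]
    refine Matrix.ext fun r c => ?_
    simp [vecMulVec_apply]
  have hMΔ : M * Δ = M * vecMulVec δv u := by
    have hbE : E *ᵥ v = -(M *ᵥ δv) := eq_neg_of_add_eq_zero_right hb
    rw [eq_neg_of_add_eq_zero_left h2, hadj, mul_vecMulVec, mul_vecMulVec, hbE]
    refine Matrix.ext fun r c => ?_
    simp [vecMulVec_apply]
  set Xm := Δ - vecMulVec v δu - vecMulVec δv u with hXm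
  have hXM : Xm * M = 0 := by
    rw [hXm, Matrix.sub_mul, Matrix.sub_mul, hΔM, vecMulVec_mul δv u M, huM, vecMulVec_zero,
      sub_zero, sub_self]
  have hMX : M * Xm = 0 := by
    rw [hXm, Matrix.mul_sub, Matrix.mul_sub, hMΔ, mul_vecMulVec M v δu, hMv, zero_vecMulVec,
      sub_zero, sub_self]
  -- rows of `Xm` lie on the left kernel line, columns on the right kernel line
  have hrow : ∀ r, ∃ cr : ℂ, Xm r = cr • u := by
    intro r
    refine exists_smul_of_vecMul_eq_zero hdet hadj0 hu huM (Xm r) ?_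
    funext c
    have h := congrFun (congrFun hXM r) c
    simpa [Matrix.mul_apply, vecMul, dotProduct] using h
  choose cr hcr using hrow
  have hXeq : Xm = vecMulVec cr u := by
    refine Matrix.ext fun r c => ?_
    have h := congrFun (hcr r) c
    simpa [vecMulVec_apply] using h
  have hMcr : M *ᵥ cr = 0 := by
    have h := hMX
    rw [hXeq, mul_vecMulVec] at h
    rcases vecMulVec_eq_zero.mp h with h' | h'
    · exact h'
    · exact absurd h' hu
  obtain ⟨lam, hlam⟩ := exists_smul_of_mulVec_eq_zero hdet hadj0 hv hMv cr hMcr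
  have hΔeq : Δ = lam • vecMulVec v u + vecMulVec v δu + vecMulVec δv u := by
    have h : Xm = lam • vecMulVec v u := by rw [hXeq, hlam, smul_vecMulVec]
    rw [hXm] at h
    rw [← h]
    abel
  refine ⟨lam, fun i => ?_⟩
  -- `(Hess δx)_i = (D ∂_i det A)(x) = tr (D(adj A)(x) · A_i)`
  have hL : ∑ j, eval x (pderiv i (pderiv j A.det)) * δx j = eval x (D (pderiv i A.det)) := by
    rw [hlink]
    exact Finset.sum_congr rfl fun j _ => by rw [pderiv_pderiv_comm]
  rw [hL, derivation_det_eq_trace_adjugate_mul (pderiv i) A, hApd i, AddMonoidHom.map_trace D,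
    map_mul_derivation, map_C_map_derivation, Matrix.mul_zero, add_zero,
    AddMonoidHom.map_trace (eval x), Matrix.map_mul, hCe]
  rw [show (A.adjugate.map D).map (eval x) = Δ from rfl, hΔeq, Matrix.add_mul, Matrix.add_mul,
    Matrix.smul_mul, trace_add, trace_add, trace_smul, vecMulVec_mul, vecMulVec_mul,
    vecMulVec_mul, trace_vecMulVec, trace_vecMulVec, trace_vecMulVec, smul_eq_mul,
    dotProduct_comm v, dotProduct_comm v, dotProduct_comm δv, ← dotProduct_mulVec,
    ← dotProduct_mulVec, ← dotProduct_mulVec]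
  ring

/-- **The reduction non-degeneracy as plain linear algebra**: if `ρ Λ = 0` and `ρ · v = 0`, where
`v_{i₀} ≠ 0` and `det (Λᵀ B'_v) ≠ 0` for the hyperplane basis `B'_v` of `v^⊥`, then `ρ = 0`
(`vecMul_eq_zero_of_left_reduction` applied to the matrix all of whose rows are `ρ`).
[cite: Sheshadri2026Border, §3.1 Step 3] -/
theorem eq_zero_of_vecMul_reduction {m : ℕ} {ρ v : Fin (m + 1) → ℂ} (hρv : ρ ⬝ᵥ v = 0)
    {i₀ : Fin (m + 1)} (hi₀ : v i₀ ≠ 0) (Λ : Matrix (Fin (m + 1)) (Fin m) ℂ)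
    (hdet : (Λᵀ * Matrix.of (fun i j => if i = i₀.succAbove j then v i₀
      else if i = i₀ then -(v (i₀.succAbove j)) else 0)).det ≠ 0)
    (hρ : ρ ᵥ* Λ = 0) : ρ = 0 := by
  set A' : Matrix (Fin (m + 1)) (Fin (m + 1)) ℂ := Matrix.of fun _ l => ρ l with hA'
  have hv : A' *ᵥ v = 0 := by
    funext r
    simp only [hA', mulVec, Pi.zero_apply]
    exact hρv
  have hrow : (Pi.single 0 1 : Fin (m + 1) → ℂ) ᵥ* A' = ρ := by
    rw [single_one_vecMul]; rfl
  have hu : ((Pi.single 0 1 : Fin (m + 1) → ℂ) ᵥ* A') ᵥ* Λ = 0 := by rw [hrow]; exact hρ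
  have h := vecMul_eq_zero_of_left_reduction hv hi₀ Λ hdet (Pi.single 0 1) hu
  rwa [hrow] at h

/-- **The bordered Hessian kills no infinitesimal polar deformation**: if the block matrix
`[[H, (a b)], [(g; c), 0]]` is invertible and `H δx = p a + q b`, `g · δx = 0`, `c · δx = 0`,
then `δx = 0` (the vector `(δx, −p, −q)` is in the kernel). [folklore] -/
theorem eq_zero_of_borderedHessian_det_ne_zero {σ : Type*} [Fintype σ] [DecidableEq σ]
    (H : Matrix σ σ ℂ) (a b g c : σ → ℂ)
    (hdet : (Matrix.fromBlocks H (Matrix.of fun (i : σ) (l : Fin 2) => ![a i, b i] l)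
      (Matrix.of fun (l : Fin 2) (j : σ) => ![g j, c j] l) (0 : Matrix (Fin 2) (Fin 2) ℂ)).det ≠ 0)
    (δx : σ → ℂ) (p q : ℂ) (hH : H *ᵥ δx = p • a + q • b) (hg : g ⬝ᵥ δx = 0)
    (hc : c ⬝ᵥ δx = 0) : δx = 0 := by
  set ξ : σ ⊕ Fin 2 → ℂ := Sum.elim δx ![-p, -q] with hξ
  have hker : (Matrix.fromBlocks H (Matrix.of fun (i : σ) (l : Fin 2) => ![a i, b i] l)
      (Matrix.of fun (l : Fin 2) (j : σ) => ![g j, c j] l) (0 : Matrix (Fin 2) (Fin 2) ℂ)) *ᵥ ξ =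
      0 := by
    rw [fromBlocks_mulVec]
    have h1 : ξ ∘ Sum.inl = δx := rfl
    have h2 : ξ ∘ Sum.inr = ![-p, -q] := rfl
    rw [h1, h2, hH, Matrix.zero_mulVec, add_zero]
    funext t
    rcases t with i | l
    · simp
      ring
    · fin_cases l
      · simpa [mulVec, dotProduct] using hg
      · simpa [mulVec, dotProduct] using hc
  have h0 := Matrix.eq_zero_of_mulVec_eq_zero hdet hker
  funext i
  exact congrFun h0 (Sum.inl i)

end PolarCountND

open PolarCountND in
/-- **Infinitesimal rigidity of a non-degenerate polar point** (the linearised kernel-incidence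
system at the lift `(1 : x, u, v)` of a polar point `x` has only torus solutions). Data: an
affine matrix `A`, a polar point `x` of `det A` for the pencil `(a, b)` with kernel pair `(u, v)`,
a reduction matrix `Λ` non-degenerate at `v`, and the bordered Hessian of `det A` at `x`
invertible. If `(δx, δu, δv)` with `E = Σ_j δx_j A_j` satisfies `c · δx = 0`,
`A(x) δv + E v = 0`, `(δuᵀ A(x) + uᵀ E) Λ = 0` and the linearised pencil equations for
`δw = (δuᵀ A_i v + uᵀ A_i δv)_i`, then `δx = 0`, `δu ∈ ℂ u`, `δv ∈ ℂ v`: the reduction gives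
`δuᵀ A(x) = −uᵀ E`, second-order Jacobi (`hessian_mulVec_eq`) gives
`Hess(det A)(x) δx = δw + λ ∇(det A)(x) ∈ ℂa + ℂb`, also `∇(det A)(x) · δx = uᵀ E v = 0`, so the
bordered Hessian kills `(δx, *, *)`. [folklore] -/
theorem polarLift_rigidity_of_nondegenerate {σ : Type*} [Fintype σ] [DecidableEq σ] {m : ℕ}
    (A : Matrix (Fin (m + 1)) (Fin (m + 1)) (MvPolynomial σ ℂ))
    (hA1 : ∀ k l, (A k l).totalDegree ≤ 1) (a b c : σ → ℂ) {j₀ k₀ : σ}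
    (hδ : a j₀ * b k₀ - a k₀ * b j₀ ≠ 0) (Λ : Matrix (Fin (m + 1)) (Fin m) ℂ)
    (x : σ → ℂ) (u v : Fin (m + 1) → ℂ) (hu : u ≠ 0) (hv : v ≠ 0)
    (huM : u ᵥ* A.map (eval x) = 0) (hMv : A.map (eval x) *ᵥ v = 0)
    (hadj : (A.map (eval x)).adjugate = vecMulVec v u)
    (hpd : ∀ i, eval x (pderiv i A.det) =
      u ⬝ᵥ (A.map (fun p => coeff (Finsupp.single i 1) p) *ᵥ v))
    (hspan : ∃ s t : ℂ, ∀ i, eval x (pderiv i A.det) = s * a i + t * b i)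
    {l₂ : Fin (m + 1)} (hvl₂ : v l₂ ≠ 0)
    (hdetΛ : (Λᵀ * Matrix.of (fun i j => if i = l₂.succAbove j then v l₂
      else if i = l₂ then -(v (l₂.succAbove j)) else 0)).det ≠ 0)
    (hND : (Matrix.fromBlocks (Matrix.of fun i j : σ => eval x (pderiv i (pderiv j A.det)))
      (Matrix.of fun (i : σ) (l : Fin 2) => ![a i, b i] l)
      (Matrix.of fun (l : Fin 2) (j : σ) => ![eval x (pderiv j A.det), c j] l)
      (0 : Matrix (Fin 2) (Fin 2) ℂ)).det ≠ 0)
    (δx : σ → ℂ) (δu δv : Fin (m + 1) → ℂ) (E : Matrix (Fin (m + 1)) (Fin (m + 1)) ℂ)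
    (hE : ∀ k l, E k l = ∑ j, coeff (Finsupp.single j 1) (A k l) * δx j)
    (δw : σ → ℂ) (hδw : ∀ i, δw i = δu ⬝ᵥ (A.map (fun p => coeff (Finsupp.single i 1) p) *ᵥ v) +
      u ⬝ᵥ (A.map (fun p => coeff (Finsupp.single i 1) p) *ᵥ δv))
    (ha : ∑ i, c i * δx i = 0)
    (hb : A.map (eval x) *ᵥ δv + E *ᵥ v = 0)
    (hc : (δu ᵥ* A.map (eval x) + u ᵥ* E) ᵥ* Λ = 0)
    (hd : ∀ i, i ≠ j₀ → i ≠ k₀ → (a j₀ * b k₀ - a k₀ * b j₀) * δw i -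
      (b k₀ * δw j₀ - b j₀ * δw k₀) * a i - (a j₀ * δw k₀ - a k₀ * δw j₀) * b i = 0) :
    δx = 0 ∧ (∃ α : ℂ, δu = α • u) ∧ (∃ β : ℂ, δv = β • v) := by
  classical
  set M := A.map (eval x) with hM
  have hdet : M.det = 0 := Matrix.exists_mulVec_eq_zero_iff.mp ⟨v, hv, hMv⟩
  have hadj0 : M.adjugate ≠ 0 := by
    rw [hadj]; exact fun h0 => (vecMulVec_eq_zero.mp h0).elim hv hu
  -- the reduction: `δuᵀ A(x) + uᵀ E = 0`
  have huE : u ⬝ᵥ (E *ᵥ v) = 0 := by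
    have h1 : u ⬝ᵥ (M *ᵥ δv + E *ᵥ v) = 0 := by rw [hb, dotProduct_zero]
    rwa [dotProduct_add, dotProduct_mulVec, huM, zero_dotProduct, zero_add] at h1
  have hρv : (δu ᵥ* M + u ᵥ* E) ⬝ᵥ v = 0 := by
    rw [add_dotProduct, ← dotProduct_mulVec, ← dotProduct_mulVec, hMv, dotProduct_zero, zero_add,
      huE]
  have hc' : δu ᵥ* M + u ᵥ* E = 0 := eq_zero_of_vecMul_reduction hρv hvl₂ Λ hdetΛ hc
  -- second-order Jacobi
  obtain ⟨lam, hlam⟩ := hessian_mulVec_eq A hA1 x u v hu hv huM hMv hadj δx δu δv E hE hb hc'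
  -- the linearised pencil equations: `δw ∈ ℂa + ℂb`
  have hd' : ∀ i, (a j₀ * b k₀ - a k₀ * b j₀) * δw i - (b k₀ * δw j₀ - b j₀ * δw k₀) * a i -
      (a j₀ * δw k₀ - a k₀ * δw j₀) * b i = 0 := by
    intro i
    by_cases hij : i = j₀
    · subst hij; ring
    by_cases hik : i = k₀
    · subst hik; ring
    exact hd i hij hik
  obtain ⟨δs, δt, hst⟩ := (polarSystem_eq_zero_iff hδ).mp hd'
  obtain ⟨s, t, hst0⟩ := hspan
  -- the bordered Hessian kills `(δx, *, *)`
  have hH : (Matrix.of fun i j : σ => eval x (pderiv i (pderiv j A.det))) *ᵥ δx =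
      (δs + lam * s) • a + (δt + lam * t) • b := by
    funext i
    have h := hlam i
    rw [← hpd i, ← hδw i, hst i, hst0 i] at h
    simp only [mulVec, dotProduct, Matrix.of_apply, Pi.add_apply, Pi.smul_apply, smul_eq_mul]
    rw [h]
    ring
  have hg : (fun j => eval x (pderiv j A.det)) ⬝ᵥ δx = 0 := by
    change ∑ j, eval x (pderiv j A.det) * δx j = 0
    rw [Finset.sum_congr rfl fun j _ => by rw [hpd j], sum_dotProduct_mulVec_mul_eq A u v δx E hE]
    exact huE
  have hcx : c ⬝ᵥ δx = 0 := ha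
  have hδx : δx = 0 :=
    eq_zero_of_borderedHessian_det_ne_zero _ a b _ c hND δx _ _ hH hg hcx
  have hE0 : E = 0 := by
    refine Matrix.ext fun k l => ?_
    simp [hE, hδx]
  refine ⟨hδx, ?_, ?_⟩
  · have h : δu ᵥ* M = 0 := by simpa [hE0] using hc'
    exact exists_smul_of_vecMul_eq_zero hdet hadj0 hu huM δu h
  · have h : M *ᵥ δv = 0 := by simpa [hE0] using hb
    exact exists_smul_of_mulVec_eq_zero hdet hadj0 hv hMv δv h

end Summit.ValiantsHypothesis.ValiantsHypothesis.Theorems.DetQPDetqpSuperquadratic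

end
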